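import Summits.HubbardSuperconductivity.HubbardSuperconductivity.Theses.AposterioriCapRg
import Summits.HubbardSuperconductivity.HubbardSuperconductivity.Theses.AbsenceCertificate
import Summits.HubbardSuperconductivity.HubbardSuperconductivity.Theorems.NodalReduction.Negative.WeakCouplingOrderCeiling
import Literature.MathematicalPhysics.QuantumLattice.DWaveOrderParameterProofs
import Literature.MathematicalPhysics.QuantumLattice.PatchPairOperator
import Literature.MathematicalPhysics.QuantumLattice.HubbardGrandCanonicalDensity
import Literature.MathematicalPhysics.QuantumLattice.TorusCooperSum
import Literature.MathematicalPhysics.QuantumLattice.DWaveSourceFreeGainBound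
import Literature.MathematicalPhysics.QuantumLattice.HubbardWave0Proofs

/-!
# Disproof of `FixedPointDWaveOrder` (stmt-HubbardSuperconductivity-1313) — standing adversary, gen 1 (cycle 1)

Crux (route `AposterioriCapRg`, rank 0 = the route's target X, auto-crux since rev 28):

  `∃ U ∈ [2,3], ∃ δ ∈ [1/5, 7/20], ∃ μ, DensityClause U δ μ ∧ HasDWaveOrder U μ`

(`crux_iff`, `Iff.rfl`), where `DensityClause U δ μ` := the grand-canonical TRACIAL ground-state density of
`hubbardTorusWith 2 (L+1) 1 U μ` tends to `1 - δ` along ALL sides `L + 1`, and `HasDWaveOrder U μ := 0 < m(U,μ)`,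
`m(U,μ) = dWaveOrderParameter U μ = liminf_{h→0⁺} liminf_L Re ω_{L+1,h}(Δ_d)/(L+1)²` (Koma–Tasaki: pair source
`-h(Δ_d + Δ_d†)`, thermodynamic limit FIRST, `DWaveSource.lean`).

VERDICT OF CYCLE 1: NO KILL, and none is in sight: the crux is the physical conjecture itself (d-wave
superconductivity of the pure `t' = 0` Hubbard model at ONE moderate point of the box), restricted to the region where
controlled numerics place a `d_{x²-y²}` BCS ground state. A disproof is an ABSENCE theorem for Koma–Tasaki d-wave order
in the interacting ground state at band fillings on the whole box (`not_crux_iff`); no technique in the tree or in print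
proves absence of `T = 0` order for an interacting Fermi system at band filling (the printed no-go theorems are `T > 0`
Mermin–Wagner statements or variational-class statements, §8). What IS proved here: the bookkeeping, the junk audit, and
TWO NEW UNCONDITIONAL NEGATIVE THEOREMS at interacting coupling — no d-wave order below the band and above the band top
`4 + U` (§5, §5b): `HasDWaveOrder U μ ⇒ μ ∈ [-4, 4+U]` for every `U ≥ 0` — filed for landing as
`Theorems/FixedPointDWaveOrder/Negative/{BelowBand,AboveBand}NoOrder.lean` (same proofs as here).

## Findings (index; every claim is a checked theorem unless marked DOC)

§1 NORMAL FORMS — `gcDensity`, `DensityClause`, `crux_iff`, `not_crux_iff` (a disproof = for every `(U,δ)` of the box and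
   every density-matched `μ`, `m(U,μ) = 0`; equivalently `¬ HasDWaveOrder`, since `0 ≤ m` always, tree
   `dWaveOrderParameter_nonneg`).
§2 ROUTE POSITION — `crux_of_chain` (the route's glue `FixedPointOfCertifiedChain` is literally [2] → [3] → R → crux);
   `closes_crux` (crux + `SsbToEvenTorusLro` ⇒ summit, the gate's deciding theorem, re-derived); THE NEGATIVE SIBLING:
   `not_hasDWaveOrder_of_sourcedVanishing` (the `AbsenceCertificate` routes' conclusion "sourced vanishing at μ" forces
   `m(U,μ) = 0`) and `not_crux_of_globalSourcedVanishing` — `AbsenceCertificate.GlobalSourcedVanishing` together with the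
   ENSEMBLE BRIDGE `EnsembleBridgeOnBox` (GC density → 1-δ at μ ⇒ μ is a supporting chemical potential of the canonical
   problem at density 1-δ: equivalence of ensembles, folklore, NOT in the tree) refutes this crux. So the two open routes
   are exact antagonists modulo equivalence of ensembles; neither side is a theorem.
§3 WHY IT RESISTS — `not_crux_imp_absence_on_box` / `crux_of_pointInBox`: ¬crux is the statement "for all `U ∈ [2,3]`,
   `δ ∈ [1/5,7/20]` and every density-matched `μ`, the Koma–Tasaki d-wave order parameter vanishes" — an absence-of-order
   theorem for the repulsive Hubbard ground state AT BAND FILLING `n ∈ [0.65, 0.8]`. The adversary's only unconditional tools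
   (`m = 0` from a SUB-LINEAR sourced energy response, tree `dWaveOrderParameter_eq_zero_of_sublinear_gain`) need a gapped or
   free reference: they bite at `U = 0` (tree, Cooper logarithm) and OUTSIDE the band (§5, this file), never at an interacting
   band filling, where the sourced response of a putative d-wave superconductor is linear by definition and that of a Fermi
   liquid is `h log(1/h)` — distinguishing the two IS the summit.
§4 LOAD-BEARING LATTICE (which clause carries what): `cruxWithNonnegOrder_iff_withoutOrder` (`0 ≤ m` is free: STRICT
   positivity is the entire order content); `CruxWithoutOrder` = the bare density clause — itself OPEN (thermodynamic limit of
   the 2-d GC ground-state energy density + no density jump across `[0.65,0.8]` at some `U ∈ [2,3]`; the tree has only the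
   CONDITIONAL `densityClause_of_regularWindows`, `HubbardGrandCanonicalDensity.lean`) — DOC; `CruxWithoutDensity`
   (`∃ U ∈ [2,3] ∃ μ, HasDWaveOrder U μ`) — OPEN, but its `μ`-range is now PROVABLY confined from below:
   `not_cruxWithoutDensity_below_band` (§5); `not_cruxAtFreeCoupling_offBand`/`_inBand` — replacing the box `U ∈ [2,3]` by the free
   point `U = 0` makes the order clause FALSE for every `μ < 0`, `μ ≠ -4` (tree `not_hasDWaveOrder_free` on `(-4,0)` + §5 below
   `-4`): the interaction is load-bearing, as it must be; `not_cruxClosedFilter` — with the NON-punctured source filter `𝓝[≥] 0`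
   the crux is FALSE at every `(U, δ, μ)` (tree `liminf_nhdsGE_liminf_dWaveSourceDensity_le_zero`): the order of limits /
   the punctured filter is load-bearing (Koma–Tasaki §1), a typing fact provers must respect when unfolding `HasDWaveOrder`.
§5 NEW NEGATIVE THEOREM — `dWaveOrderParameter_eq_zero_below_band` / `not_hasDWaveOrder_below_band`: for EVERY `U ≥ 0` and
   EVERY `μ < -4`, `m(U,μ) = 0`. Proof: four operator inequalities in momentum space (`L ≥ 3`) — (P1) `K_U - K_0 = U·D ≥ 0`;
   (P2) `K_0 - gN = Σ_{kσ}(ε_k + 4)n_{kσ} ≥ 0`, `g = -4-μ`; (P3) `N - Σ_k b_k†b_k ≥ 0` (`n_{k↑} - b_k†b_k = Y†Y` by CAR);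
   (P4) `gΣb†b - h(Δ_d+Δ_d†) + c_L(h) = Σ_k g⁻¹(g b_k + a_k)†(g b_k + a_k) ≥ 0`, `a_k = 2√2 h ĝ_d(k)`, `c_L(h) ≤ 32h²L²/g` — so
   `E₀(H_{L,h}) ≥ -32h²L²/g` while `E₀(H_{L,0}) ≤ ⟨vac, K_U vac⟩ = 0`: QUADRATIC sourced gain, and the tree's sub-linear-gain
   criterion gives `m = 0`. Also `gcDensity_eq_zero_below_band`: there the GC tracial density is IDENTICALLY `0` from side 3 on
   (`ω(K_U - gN) ≥ 0`, `ω(K_U) = E₀ ≤ 0`, `ω(N) ≥ 0`), so `not_densityClause_below_band`: BOTH conjuncts of the crux fail below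
   the band — the region is doubly dead, and the two clauses agree on where the content lives. §5b THE MIRROR ABOVE THE BAND
   TOP (`dWaveOrderParameter_eq_zero_above_band` / `not_hasDWaveOrder_above_band`): for every `U ≥ 0` and `μ > 4 + U`,
   `m(U,μ) = 0`, by the particle–hole twin with the FILLED state as reference — (P1⁺) `D + L²·1 - N = Σ_x (1-n↑)(1-n↓) =
   Σ_x (c†_{x↑}c†_{x↓})†(c†_{x↑}c†_{x↓}) ≥ 0`, (P2⁺) `K_0 - C_L(μ)1 - (μ-4)(2L²1 - N) = Σ_{kσ}(4-ε_k)c_{kσ}c†_{kσ} ≥ 0`,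
   (P3⁺) `(2L²1 - N) - Σ_k b_k b_k† ≥ 0`, (P4⁺) completed squares with `b_k†`; `E₀(K_U) ≤ ⟨full,K_U full⟩ ≤ C_L(μ) + UL²`.
   Also `re_groundStateFunctional_totalNumber_eq_two_mul` / `not_densityClause_above_band`: there the GC density is
   IDENTICALLY `2` from side 3 on, so the density conjunct fails too, and `mem_band_window_of_densityClause`: the DENSITY
   clause alone also forces `μ ∈ [-4, 4+U]` for dopings in the box — the two conjuncts independently point at the band.
   TOGETHER (`mem_band_window_of_hasDWaveOrder`): `HasDWaveOrder U μ ⇒ μ ∈ [-4, 4+U]` at every `U ≥ 0`; hence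
   `crux_iff_inWindow`: the crux is EQUIVALENT to its restriction `μ ∈ [-4, 4+U] ⊆ [-4, 7]` — the `∃ μ : ℝ` is a bounded
   search, provably. Filed for landing in two parts: `Negative/BelowBandNoOrder.lean`, `Negative/AboveBandNoOrder.lean`.
§6 JUNK AUDIT (checked `example`s) — `HasDWaveOrder U μ ↔ 0 < m` is `Iff.rfl`; `0 ≤ m ≤ 4√2` for ALL `U, μ` (tree), so the
   double `liminf` never meets `sSup ∅`/unbounded junk; `((L+1 : ℕ) : ℝ)^2 > 0`; the Hamiltonians are Hermitian
   (`isHermitian_hubbardTorusWith`, `dWaveSourceTorus_isHermitian`) so the tracial ground state is honest; `Set.Icc` boxes are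
   closed and nonempty (`(3, 1/5)` is a point, `corner_mem_box`); `DensityClause` runs over ALL sides incl. `L+1 = 1, 2` (immaterial
   under `Tendsto … atTop`) and incl. ODD sides (material: a density-wave competitor commensurate only with even sides would make
   the two parity subsequences differ — cf. `SsbToEvenTorusLro/Disproof.lean` §8 — but for a UNIFORM d-wave phase this is no
   hazard); the small parameter of the route (scale count) is invisible in the statement, as it should be for a target.
§7 SYMMETRY AUDIT (DOC + `dWaveSourceDensity_zero`): the `C₄` rotation maps `Δ_d ↦ -Δ_d` AND `H_{L,h} ↦ H_{L,-h}`; composed with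
   the gauge rotation `c ↦ e^{iπ/2}c` (`Δ_d ↦ -Δ_d`, `K_U` fixed) it is a symmetry of `H_{L,h}` FIXING `Δ_d` — no symmetry of the
   sourced problem forces `Re ω_h(Δ_d) = 0` at `h > 0` (only at `h = 0`: tree `dWaveSourceDensity_zero`, `U(1)`); the model is real
   (time-reversal even) so `ω_h(Δ_d)` is automatically real; spin `SU(2)` fixes the singlet `Δ_d`. Sign: `m_L(h) ≥ 0` for `h ≥ 0`
   always (tree `dWaveSourceDensity_nonneg`), `> 0` iff the source lowers the energy. No symmetry kill exists.
§8 HAZARD AUDIT (DOC; physics, not theorems). (i) PRINTED NO-GO THEOREMS: Koma–Tasaki PRL 68 (1992) 3248 and its d-wave /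
   extended-s extensions (Su–Suzuki 1998-type statements) exclude pairing LRO at `T > 0` in `d ≤ 2` (Mermin–Wagner /
   Bogoliubov inequality; catalogued `Literature.Barriers.HubbardSuperconductivity.HohenbergMerminWagnerPairing`,
   `PositiveTemperatureNoPairLRO`) — silent at `T = 0`; Bach–Lieb–Solovej 1994 (catalogued `GeneralizedHartreeFockNoPairing`):
   generalized HF states of the REPULSIVE Hubbard model never pair — a statement about a variational class, not about ground
   states; `PureModelStripeCompetition` (Qin et al. 2020, `(U,δ) = (8,1/8)`) is registered OPEN and sits far outside the box;
   `WeakCouplingCeiling` / `StrongCouplingCeiling` constrain TECHNIQUES (expansions), not the truth value. None bites.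
   (ii) NUMERICS IN THE BOX (`t' = 0`, `U ∈ [2,3]`, `n ∈ [0.65,0.8]`): diagrammatic Monte Carlo in the "emergent BCS regime" —
   "the emergent BCS regime has been found to extend at least up to U ≲ 4 and n ≲ 0.8, and a phase diagram has been obtained
   [Deng et al. 2015], … while the d_{x²−y²}-pairing at larger densities is robust" (Šimkovic–Deng–Kozik, PRB 104 (2021)
   L020507 = arXiv:1912.13054, p. 1); "the maximal … effective coupling λ_max reaches ≈ 0.25 at U = 3 and n = n_VH, where it is
   of the d_{x²−y²} character" (ibid. p. 4, at `t' = 0.3`); at `t' = 0` and lower density `d_xy`/`p` take over below `n ≈ 0.6`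
   (Deng et al. 2015 Fig. 1; RKS2010 Fig. 2: `d_{x²-y²}` for `0.6 < n < 1` at weak coupling). So the consensus EXPECTS the
   crux to be TRUE at, e.g., the planner's corner `(3, 1/5)` (n = 0.8), with an exponentially small but nonzero gap; the
   adversary records the two live physical competitors, neither a theorem: (a) an incommensurate SDW pre-empting pairing near
   the corner (bare RPA Stoner product `U·χ₀ ≈ 1.22` at `(3, 0.8)` by the route's own numbers, screened `≈ 0.8–0.9`; constrained-path
   AFQMC, Xu–Shi–Vitali–Qin–Zhang PRR 4 (2022) 013239 = arXiv:2112.02187: "the critical interaction strength U_c(δ) increase[s]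
   with the doping level δ … The SDW or stripe order persists from small doping near half-filling to doping levels as large as
   1/5" (p. 7) with `U_c` already between 2 and 4 at `δ = 1/12` (TDL staggered structure factor `-0.003(5)` at `U = 2` vs
   `0.123(9)` at `U = 4`, p. 4) — so at the corner `(3, δ = 1/5)` no magnetic order is expected, while AFQMC cannot resolve an
   exponentially small pairing gap either way), and (b) a `B₁g → B₂g` (`d_xy`) switch at the low-density edge `n = 0.65` for
   `U → 2` — both would only MOVE the point inside the `∃`, not empty the box. (iii) THE TENSION THAT COULD EMPTY THE BOX is
   phase separation / a first-order density jump across the whole interval `[0.65, 0.8]` at every `U ∈ [2,3]` (then no `μ`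
   satisfies the density clause) — against the numerics ("we did not find phase separation or non-filled SDW/stripe orders which
   survived in our finite-size scaling procedure", ibid. p. 7, even at strong coupling), unrefutable and unprovable today. (iv) The negative programme
   `AbsenceCertificate` (§2) would, if ever certified at level `R`, kill this crux pointwise; its own disprover records the
   symmetric obstruction (an SOS certificate of `Re ω(P₀) ≤ η` at a superconducting point cannot exist).
§9 TARGETS — none this cycle (payload `targets = []`, `stuck_stubs = []`; no line picked for this item).
§10 NEAR-MISSES — none claimed; no `sorry` in this file. Cycle-2 queue: the band-EDGE points `μ = -4`, `μ = 4 + U` (no gap: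
   needs the `O(h²)` response from `ĝ_d(0) = ĝ_d(π,π) = 0`); the free slice `μ ∈ [0, 4]` at `U = 0` (particle–hole on even
   sides + the tree's Cooper-log ceiling); inside the band NOTHING is attackable with a gapped reference — the Hartree window
   `[-4, 4+U]` is where the physics lives; a Lean statement of the ensemble bridge as a filed support item if a planner wants
   the antagonism of §2 typed.

Search record (cycle 1, 2026-08-16; searchd local FTS DOWN, OpenAlex/S2 429, arXiv OK): `lit search "nonexistence d-wave
superconductivity Hubbard"` (crossref only: Matuttis–Ito 2005 QMC 'nonexistence' = numerics; no theorem), `lit search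
"emergent BCS regime … diagrammatic Monte Carlo"` → arXiv:1408.2088 (DengEtAl2015, held), arXiv:1912.13054 (read pp. 1–4,
quoted above), `lit read doi:10.1103/physrevresearch.4.013239` (XuEtAl2022 = arXiv:2112.02187, pp. 1, 4, 6, 7 read, quoted
above); `ledger negatives --problem HubbardSuperconductivity` (1 entry, KlsOrderOpenness, unrelated); barrier catalogue
`Literature/Barriers/HubbardSuperconductivity/*` (8 entries, none at `T = 0` band filling); sister work files
`Cruxes/{SsbToEvenTorusLro,WcbcsSsbToTorusLRO,NodalReduction,CwChiralConstruction,AposterioriOrderCriterionR}/Disproof.lean`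
(cited, not imported).
-/

noncomputable section

set_option linter.dupNamespace false

namespace Summit.HubbardSuperconductivity.HubbardSuperconductivity.Cruxes.FixedPointDWaveOrder.Disproof

open Literature.MathematicalPhysics.QuantumLattice Literature.Probability.LatticeModels
open Filter Set Matrix Finset
open scoped ComplexOrder Matrix.Norms.L2Operator
open _root_.Topology
open Summit.HubbardSuperconductivity.HubbardSuperconductivity.Theses.AposterioriCapRg
open Summit.HubbardSuperconductivity.HubbardSuperconductivity.Theses.AbsenceCertificate (GlobalSourcedVanishing)

/-! ## §1 Normal forms -/

/-- The grand-canonical tracial ground-state density on the torus of side `L + 1`: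
`n_{L+1}(U,μ) = Re ω₀[hubbardTorusWith 2 (L+1) 1 U μ](N) / (L+1)²`. -/
def gcDensity (U μ : ℝ) (L : ℕ) : ℝ :=
  ((hubbardTorusWith 2 (L + 1) 1 U μ).groundStateFunctional totalNumber).re / ((L + 1 : ℕ) : ℝ) ^ 2

/-- The density clause of the crux: `n_{L+1}(U,μ) → 1 - δ` along ALL sides. -/
def DensityClause (U δ μ : ℝ) : Prop :=
  Tendsto (fun L : ℕ => gcDensity U μ L) atTop (𝓝 (1 - δ))

/-- The crux in normal form (definitional). -/
theorem crux_iff :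
    FixedPointDWaveOrder ↔
      ∃ U ∈ Icc (2:ℝ) 3, ∃ δ ∈ Icc (1/5:ℝ) (7/20), ∃ μ : ℝ, DensityClause U δ μ ∧ 0 < dWaveOrderParameter U μ :=
  Iff.rfl

/-- A disproof in normal form: on the whole box, every density-matched `μ` has vanishing order parameter
(`0 ≤ m` always, so `¬ 0 < m ↔ m = 0`). -/
theorem not_crux_iff :
    ¬ FixedPointDWaveOrder ↔
      ∀ U ∈ Icc (2:ℝ) 3, ∀ δ ∈ Icc (1/5:ℝ) (7/20), ∀ μ : ℝ, DensityClause U δ μ → dWaveOrderParameter U μ = 0 := by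
  rw [crux_iff]
  constructor
  · intro h U hU δ hδ μ hd
    have hnn := dWaveOrderParameter_nonneg U μ
    by_contra hne
    exact h ⟨U, hU, δ, hδ, μ, hd, lt_of_le_of_ne hnn (Ne.symm hne)⟩
  · rintro h ⟨U, hU, δ, hδ, μ, hd, hpos⟩
    rw [h U hU δ hδ μ hd] at hpos
    exact lt_irrefl _ hpos

/-- The planner's proposal point `(U, δ) = (3, 1/5)` lies in the box (non-vacuity of the parameter ranges). -/
theorem corner_mem_box : (3:ℝ) ∈ Icc (2:ℝ) 3 ∧ (1/5:ℝ) ∈ Icc (1/5:ℝ) (7/20) :=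
  ⟨⟨by norm_num, le_rfl⟩, ⟨le_rfl, by norm_num⟩⟩

/-- A single certified point in the box proves the crux (the `∃`-shape: the constructor picks the point). -/
theorem crux_of_pointInBox {U δ μ : ℝ} (hU : U ∈ Icc (2:ℝ) 3) (hδ : δ ∈ Icc (1/5:ℝ) (7/20))
    (hd : DensityClause U δ μ) (hord : HasDWaveOrder U μ) : FixedPointDWaveOrder :=
  ⟨U, hU, δ, hδ, μ, hd, hord⟩

/-! ## §2 Route position and the negative sibling -/

/-- The route's glue item is, by definition, the implication chain into the crux. -/
theorem crux_of_chain (h2 : CapRgSymmetricCertificatePinned) (h3 : SeededBrokenRegimeBoseFermiPinned)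
    (hR : AposterioriOrderCriterionR) (hglue : FixedPointOfCertifiedChain) : FixedPointDWaveOrder :=
  hglue h2 h3 hR

/-- The deciding theorem, re-derived: crux + every-ground-state transfer ⇒ summit. -/
theorem closes_crux (hT : FixedPointDWaveOrder) (hS : SsbToEvenTorusLro) : _root_.HubbardSuperconductivity :=
  -- buildfix 2026-08-19: the route's `closes` now consumes the certified chain; go through the landed `Assembly`.
  Assembly_holds hS hT

/-- "Sourced vanishing at `μ`" — the conclusion of the `AbsenceCertificate` routes
(`UniversalSourcedVanishing`, `GlobalSourcedVanishing`, `StripeSourcedVanishing`): for every `η > 0` the sourced d-wave pair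
density is eventually (small `h`, then large `L`) below `η`. -/
def SourcedVanishing (U μ : ℝ) : Prop :=
  ∀ η : ℝ, 0 < η → ∃ h₀ : ℝ, 0 < h₀ ∧ ∀ h : ℝ, h ∈ Ioo (0:ℝ) h₀ →
    ∃ L₀ : ℕ, ∀ (L : ℕ) [NeZero L], L₀ ≤ L → dWaveSourceDensity L U μ h ≤ η

/-- **Sourced vanishing kills the Koma–Tasaki order parameter**: `SourcedVanishing U μ → m(U,μ) = 0`
(the order parameter is below every stair `liminf_L density(h)`, tree `dWaveOrderParameter_le_liminf`). -/
theorem dWaveOrderParameter_eq_zero_of_sourcedVanishing {U μ : ℝ} (h : SourcedVanishing U μ) :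
    dWaveOrderParameter U μ = 0 := by
  refine le_antisymm ?_ (dWaveOrderParameter_nonneg U μ)
  refine le_of_forall_pos_le_add fun η hη => ?_
  rw [zero_add]
  obtain ⟨h₀, hh₀, hstair⟩ := h η hη
  have hh : (0:ℝ) < h₀ / 2 := by positivity
  obtain ⟨L₀, hL₀⟩ := hstair (h₀ / 2) ⟨hh, by linarith⟩
  refine (dWaveOrderParameter_le_liminf U μ hh).trans ?_
  refine liminf_le_of_frequently_le (Eventually.frequently ?_) ?_
  · filter_upwards [eventually_ge_atTop L₀] with L hL
    exact hL₀ (L + 1) (by omega)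
  · exact isBoundedUnder_of_eventually_ge (a := 0)
      (Eventually.of_forall fun L => dWaveSourceDensity_nonneg U μ hh.le)

/-- Hence sourced vanishing excludes `HasDWaveOrder`. -/
theorem not_hasDWaveOrder_of_sourcedVanishing {U μ : ℝ} (h : SourcedVanishing U μ) : ¬ HasDWaveOrder U μ := by
  rw [hasDWaveOrder_iff, dWaveOrderParameter_eq_zero_of_sourcedVanishing h]
  exact lt_irrefl 0

/-- "`μ` is a supporting chemical potential of the canonical problem at doping `δ`" — the hypothesis of
`AbsenceCertificate.GlobalSourcedVanishing`, verbatim: the canonical `(N_L, S^z = 0)`-sector energy minus `μ N_L` matches the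
grand-canonical ground energy up to `o(L²)` along even sides, `N_L = 2⌊(1-δ)L²/2⌋`. -/
def IsSupportingPotential (U δ μ : ℝ) : Prop :=
  ∀ ε : ℝ, 0 < ε → ∃ L₀ : ℕ, ∀ L : ℕ, Even L → L₀ ≤ L →
    |(hubbardTorus 2 L 1 U).minEnergyOn (szSector (2 * ⌊(1 - δ) * (L : ℝ) ^ 2 / 2⌋₊) 0) -
        μ * ((2 * ⌊(1 - δ) * (L : ℝ) ^ 2 / 2⌋₊ : ℕ) : ℝ) - Matrix.groundEnergy (hubbardTorusWith 2 L 1 U μ)| ≤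
      ε * (L : ℝ) ^ 2

/-- THE ENSEMBLE BRIDGE on the box (equivalence of ensembles, folklore, NOT in the tree): a chemical potential at which the
grand-canonical tracial density tends to `1 - δ` is a supporting chemical potential at doping `δ`. Recorded as an explicit
hypothesis; it is what separates this crux from the negation of the `AbsenceCertificate` programme. -/
def EnsembleBridgeOnBox : Prop :=
  ∀ U ∈ Icc (2:ℝ) 3, ∀ δ ∈ Icc (1/5:ℝ) (7/20), ∀ μ : ℝ, DensityClause U δ μ → IsSupportingPotential U δ μ

/-- `GlobalSourcedVanishing` unfolded at a point of the box: supporting potential ⇒ sourced vanishing. -/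
theorem sourcedVanishing_of_global (hG : GlobalSourcedVanishing) {U δ μ : ℝ} (hU : U ∈ Icc (2:ℝ) 3)
    (hδ : δ ∈ Icc (1/5:ℝ) (7/20)) (hμ : IsSupportingPotential U δ μ) : SourcedVanishing U μ := by
  have hU0 : (0:ℝ) < U := by linarith [hU.1]
  have hδ' : δ ∈ Ioo (0:ℝ) (1 / 2) := ⟨by linarith [hδ.1], by linarith [hδ.2]⟩
  exact hG U hU0 δ hδ' μ hμ

/-- **The two open programmes are antagonists modulo equivalence of ensembles**: the negative sibling
`AbsenceCertificate.GlobalSourcedVanishing` plus the ensemble bridge refutes this crux. (Neither hypothesis is a theorem;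
this records the logical geometry, it is not a conditional refutation of anything.) -/
theorem not_crux_of_globalSourcedVanishing (hG : GlobalSourcedVanishing) (hB : EnsembleBridgeOnBox) :
    ¬ FixedPointDWaveOrder := by
  rintro ⟨U, hU, δ, hδ, μ, hd, hord⟩
  exact not_hasDWaveOrder_of_sourcedVanishing (sourcedVanishing_of_global hG hU hδ (hB U hU δ hδ μ hd)) hord

/-- Conversely the crux refutes the conjunction (same content, contrapositive form for the planners of both routes). -/
theorem not_global_and_bridge_of_crux (h : FixedPointDWaveOrder) : ¬ (GlobalSourcedVanishing ∧ EnsembleBridgeOnBox) :=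
  fun hGB => not_crux_of_globalSourcedVanishing hGB.1 hGB.2 h

/-! ## §3 Why it resists -/

/-- The armour: a disproof is an absence-of-order theorem on the WHOLE box at every density-matched `μ`. -/
theorem not_crux_imp_absence_on_box (h : ¬ FixedPointDWaveOrder) {U δ μ : ℝ} (hU : U ∈ Icc (2:ℝ) 3)
    (hδ : δ ∈ Icc (1/5:ℝ) (7/20)) (hd : DensityClause U δ μ) : ¬ HasDWaveOrder U μ :=
  fun hord => h ⟨U, hU, δ, hδ, μ, hd, hord⟩

/-- … and nothing weaker: absence at SOME points of the box is consistent with the crux (abstract independence; witness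
predicates `P := (U = 3)`: "order at `U = 3`, none at `U = 2`" satisfies an `∃` over the box and a `¬` elsewhere). -/
theorem exists_and_not_elsewhere_consistent :
    ∃ P : ℝ → Prop, (∃ U ∈ Icc (2:ℝ) 3, P U) ∧ (∃ U ∈ Icc (2:ℝ) 3, ¬ P U) :=
  ⟨fun U => U = 3, ⟨3, ⟨by norm_num, le_rfl⟩, rfl⟩, ⟨2, ⟨le_rfl, by norm_num⟩, by norm_num⟩⟩

/-! ## §4 Load-bearing lattice -/

/-- The crux with the order clause weakened to `0 ≤ m`. -/
def CruxWithNonnegOrder : Prop :=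
  ∃ U ∈ Icc (2:ℝ) 3, ∃ δ ∈ Icc (1/5:ℝ) (7/20), ∃ μ : ℝ, DensityClause U δ μ ∧ 0 ≤ dWaveOrderParameter U μ

/-- The crux with the order clause dropped: the bare density clause on the box. OPEN (thermodynamic limit + no density jump;
DOC §4). -/
def CruxWithoutOrder : Prop :=
  ∃ U ∈ Icc (2:ℝ) 3, ∃ δ ∈ Icc (1/5:ℝ) (7/20), ∃ μ : ℝ, DensityClause U δ μ

/-- `0 ≤ m` is free (tree `dWaveOrderParameter_nonneg`): the weakened crux IS the bare density clause — strict positivity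
carries the entire order content. -/
theorem cruxWithNonnegOrder_iff_withoutOrder : CruxWithNonnegOrder ↔ CruxWithoutOrder := by
  constructor
  · rintro ⟨U, hU, δ, hδ, μ, hd, -⟩; exact ⟨U, hU, δ, hδ, μ, hd⟩
  · rintro ⟨U, hU, δ, hδ, μ, hd⟩; exact ⟨U, hU, δ, hδ, μ, hd, dWaveOrderParameter_nonneg U μ⟩

/-- The crux implies both weakenings (relative strength only). -/
theorem cruxWithoutOrder_of_crux (h : FixedPointDWaveOrder) : CruxWithoutOrder := by
  obtain ⟨U, hU, δ, hδ, μ, hd, -⟩ := h; exact ⟨U, hU, δ, hδ, μ, hd⟩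

/-- The crux with the density clause dropped: Koma–Tasaki d-wave order somewhere on `[2,3] × ℝ`. OPEN; its `μ`-range is
confined from below by §5 (`not_cruxWithoutDensity_below_band`). -/
def CruxWithoutDensity : Prop :=
  ∃ U ∈ Icc (2:ℝ) 3, ∃ μ : ℝ, HasDWaveOrder U μ

/-- The crux implies the density-free weakening. -/
theorem cruxWithoutDensity_of_crux (h : FixedPointDWaveOrder) : CruxWithoutDensity := by
  obtain ⟨U, hU, δ, -, μ, -, hord⟩ := h; exact ⟨U, hU, μ, hord⟩

/-- The crux with the NON-punctured source filter `𝓝[≥] 0` in place of `𝓝[>] 0` (everything else verbatim). -/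
def CruxClosedFilter : Prop :=
  ∃ U ∈ Icc (2:ℝ) 3, ∃ δ ∈ Icc (1/5:ℝ) (7/20), ∃ μ : ℝ, DensityClause U δ μ ∧
    0 < liminf (fun h : ℝ => liminf (fun L : ℕ => dWaveSourceDensity (L + 1) U μ h) atTop) (𝓝[≥] 0)

/-- **The punctured filter is load-bearing**: through `𝓝[≥] 0` the double liminf is `≤ 0` at every `(U, μ)` (the slice
`h = 0` vanishes identically by `U(1)`, tree `liminf_nhdsGE_liminf_dWaveSourceDensity_le_zero`), so the closed-filter crux is
FALSE outright. -/
theorem not_cruxClosedFilter : ¬ CruxClosedFilter := by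
  rintro ⟨U, -, δ, -, μ, -, hpos⟩
  exact (not_le.mpr hpos) (liminf_nhdsGE_liminf_dWaveSourceDensity_le_zero U μ)

/-- The crux with the box `U ∈ [2,3]` replaced by the FREE point `U = 0` (density clause kept verbatim). -/
def CruxAtFreeCoupling : Prop :=
  ∃ δ ∈ Icc (1/5:ℝ) (7/20), ∃ μ : ℝ, DensityClause 0 δ μ ∧ HasDWaveOrder 0 μ

/-- **The interaction is load-bearing, in-band half**: at `U = 0` the order clause fails for every `μ ∈ (-4, 0)` (tree
`NodalReduction.Negative.not_hasDWaveOrder_free`: BdG Cooper logarithm, sub-linear response `∼ h log(1/h)`), so no witness of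
`CruxAtFreeCoupling` has `μ` in the hole-doped band. (The below-band half is `not_cruxAtFreeCoupling_below_band`, §5; the
band-edge point `μ = -4` and `μ ≥ 0` are cycle-2 items, §10.) -/
theorem not_cruxAtFreeCoupling_inBand :
    ¬ ∃ δ ∈ Icc (1/5:ℝ) (7/20), ∃ μ ∈ Ioo (-4:ℝ) 0, DensityClause 0 δ μ ∧ HasDWaveOrder 0 μ := by
  rintro ⟨δ, -, μ, hμ, -, hord⟩
  exact Summit.HubbardSuperconductivity.HubbardSuperconductivity.Theorems.NodalReduction.Negative.not_hasDWaveOrder_free μ hμ hord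

/-! ## §5 The new negative theorem: no d-wave order below the band, at every repulsion

Same statements and proofs as the filed support file `Theorems/FixedPointDWaveOrder/Negative/BelowBandNoOrder.lean`
(namespace `Summit.HubbardSuperconductivity.FixedPointDWaveOrder.Negative`); duplicated here because a work file may import
only the tree. -/

section BelowBand

variable {L : ℕ} [NeZero L]

/-- `n_{k↑} - b_k† b_k = Y† Y` with `Y = c†_{-k↓} c_{k↑}` (CAR `c_{-k↓} c†_{-k↓} = 1 - c†_{-k↓} c_{-k↓}`). -/
theorem momentumNumber_sub_pairMode_sq (k : TorusSite 2 L) :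
    momentumNumber k 0 - (pairMode k)ᴴ * pairMode k =
      (momentumCreation (-k) 1 * momentumAnnihilation k 0)ᴴ *
        (momentumCreation (-k) 1 * momentumAnnihilation k 0) := by
  have hcar := momentumAnnihilation_mul_momentumCreation (d := 2) (L := L) (-k) (-k) (1 : Fin 2) 1
  simp only [and_self, if_true] at hcar
  have hcc : (momentumCreation (-k) (1 : Fin 2) : Matrix (Finset (Orb (FermionTorus 2 L))) _ ℂ)ᴴ =
      momentumAnnihilation (-k) 1 := by
    rw [momentumCreation, conjTranspose_conjTranspose]
  rw [pairMode_conjTranspose, pairMode, momentumNumber, conjTranspose_mul, hcc,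
    momentumAnnihilation_conjTranspose]
  rw [Matrix.mul_assoc (momentumCreation k 0) (momentumAnnihilation (-k) 1),
    ← Matrix.mul_assoc (momentumAnnihilation (-k) 1), hcar]
  simp only [Matrix.sub_mul, Matrix.one_mul, Matrix.mul_sub, Matrix.mul_assoc]

/-- `b_k† b_k ≤ n_{k↑}` as operators. -/
theorem posSemidef_momentumNumber_sub_pairMode (k : TorusSite 2 L) :
    (momentumNumber k 0 - (pairMode k)ᴴ * pairMode k).PosSemidef := by
  rw [momentumNumber_sub_pairMode_sq]
  exact posSemidef_conjTranspose_mul_self _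

/-- The completed square of a sourced pair mode: for real `g ≠ 0` and `a`,
`g b†b + a (b + b†) + (a²/g) 1 = g⁻¹ (g b + a 1)† (g b + a 1)`. -/
theorem pairMode_square_identity (k : TorusSite 2 L) {g : ℝ} (hg : g ≠ 0) (a : ℝ) :
    (g : ℂ) • ((pairMode k)ᴴ * pairMode k) + (a : ℂ) • (pairMode k + (pairMode k)ᴴ) +
        ((a ^ 2 / g : ℝ) : ℂ) • (1 : Matrix (Finset (Orb (FermionTorus 2 L))) _ ℂ) =
      ((g⁻¹ : ℝ) : ℂ) • (((g : ℂ) • pairMode k + (a : ℂ) • 1)ᴴ * ((g : ℂ) • pairMode k + (a : ℂ) • 1)) := by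
  have hg' : (g : ℂ) ≠ 0 := Complex.ofReal_ne_zero.mpr hg
  simp only [conjTranspose_add, conjTranspose_smul, conjTranspose_one, Complex.star_def,
    Complex.conj_ofReal, Matrix.add_mul, Matrix.mul_add, Matrix.smul_mul, Matrix.mul_smul,
    Matrix.one_mul, Matrix.mul_one, smul_add, smul_smul]
  push_cast
  field_simp
  module

/-- Hence `g b†b + a (b + b†) + (a²/g) 1 ≥ 0` for `g > 0`. -/
theorem posSemidef_pairMode_square (k : TorusSite 2 L) {g : ℝ} (hg : 0 < g) (a : ℝ) :
    ((g : ℂ) • ((pairMode k)ᴴ * pairMode k) + (a : ℂ) • (pairMode k + (pairMode k)ᴴ) +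
        ((a ^ 2 / g : ℝ) : ℂ) • (1 : Matrix (Finset (Orb (FermionTorus 2 L))) _ ℂ)).PosSemidef := by
  rw [pairMode_square_identity k hg.ne' a]
  exact posSemidef_ofReal_smul (posSemidef_conjTranspose_mul_self _) (inv_nonneg.mpr hg.le)

omit [NeZero L] in
/-- (P1) Repulsion is positive: `K_U - K_0 = U Σ_x n_{x↑}n_{x↓} ≥ 0` for `U ≥ 0`. -/
theorem posSemidef_hubbardTorusWith_sub_free {U : ℝ} (hU : 0 ≤ U) (μ : ℝ) :
    (hubbardTorusWith 2 L 1 U μ - hubbardTorusWith 2 L 1 0 μ).PosSemidef := by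
  rw [hubbardTorusWith, hubbardTorusWith, hamiltonianWith_sub_hamiltonianWith, sub_zero]
  exact posSemidef_ofReal_smul (posSemidef_sum_numberOp_mul_numberOp (Λ := FermionTorus 2 L)) hU

/-- (P2) Below the band the free grand-canonical Hamiltonian dominates `(-4 - μ) N`:
`K_0 - (-4 - μ) N = Σ_{kσ} (ε_k + 4) n_{kσ} ≥ 0` (`ε_k ≥ -4`; momentum representation, `L ≥ 3`). -/
theorem posSemidef_free_sub_gap_smul_totalNumber (hL : 3 ≤ L) (μ : ℝ) :
    (hubbardTorusWith 2 L 1 0 μ - (((-4 - μ : ℝ)) : ℂ) • totalNumber).PosSemidef := by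
  rw [hubbardTorusWith_zero_eq_sum_momentumNumber hL μ, totalNumber_eq_sum_momentumNumber,
    Finset.smul_sum, ← Finset.sum_sub_distrib]
  refine posSemidef_sum _ fun k _ => ?_
  rw [Finset.smul_sum, ← Finset.sum_sub_distrib]
  refine posSemidef_sum _ fun σ _ => ?_
  rw [← sub_smul, ← Complex.ofReal_sub]
  refine posSemidef_ofReal_smul (posSemidef_momentumNumber k σ) ?_
  have := neg_four_le_torusBand L k
  linarith

/-- (P3) The pair modes are dominated by the particle number: `N - Σ_k b_k† b_k ≥ 0`. -/
theorem posSemidef_totalNumber_sub_sum_pairMode :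
    ((totalNumber : Matrix (Finset (Orb (FermionTorus 2 L))) _ ℂ) -
        ∑ k : TorusSite 2 L, (pairMode k)ᴴ * pairMode k).PosSemidef := by
  have hrepr : ((totalNumber : Matrix (Finset (Orb (FermionTorus 2 L))) _ ℂ) -
        ∑ k : TorusSite 2 L, (pairMode k)ᴴ * pairMode k) =
      ∑ k : TorusSite 2 L, (momentumNumber k 0 - (pairMode k)ᴴ * pairMode k) +
        ∑ k : TorusSite 2 L, momentumNumber k 1 := by
    rw [totalNumber_eq_sum_momentumNumber]
    simp only [Fin.sum_univ_two, Finset.sum_add_distrib, Finset.sum_sub_distrib]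
    abel
  rw [hrepr]
  exact (posSemidef_sum _ fun k _ => posSemidef_momentumNumber_sub_pairMode k).add
    (posSemidef_sum _ fun k _ => posSemidef_momentumNumber k 1)

/-- The source operator in momentum space: `-(Δ_d + Δ_d†) = 2√2 Σ_k ĝ_d(k) (b_k + b_k†)`. -/
theorem neg_pairField_add_conjTranspose_eq_sum :
    -(pairField dWaveFormFactor L + (pairField dWaveFormFactor L)ᴴ) =
      ∑ k : TorusSite 2 L, ((2 * Real.sqrt 2 * dWaveGap k : ℝ) : ℂ) • (pairMode k + (pairMode k)ᴴ) := by
  rw [pairField_dWave_eq_smul_pairOperator, pairOperator]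
  simp only [conjTranspose_neg, conjTranspose_smul, conjTranspose_sum, Complex.star_def,
    Complex.conj_ofReal, neg_add_rev, neg_neg, Finset.smul_sum, smul_smul, smul_add,
    ← Complex.ofReal_mul, Finset.sum_add_distrib]
  abel

/-- The constant of the completed squares is quadratic in the source and extensive:
`Σ_k (2√2 ĝ_d(k) h)²/g ≤ 32 h² L² / g` for `g > 0` (`|ĝ_d| ≤ 2`, `|Λ_L| = L²`). -/
theorem sourceShift_le {g : ℝ} (hg : 0 < g) (h : ℝ) :
    ∑ k : TorusSite 2 L, (2 * Real.sqrt 2 * dWaveGap k * h) ^ 2 / g ≤ 32 * h ^ 2 / g * (L : ℝ) ^ 2 := by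
  have hterm : ∀ k : TorusSite 2 L, (2 * Real.sqrt 2 * dWaveGap k * h) ^ 2 / g ≤ 32 * h ^ 2 / g := by
    intro k
    have h2 : Real.sqrt 2 ^ 2 = 2 := Real.sq_sqrt (by norm_num)
    have hgk := abs_dWaveGap_le_two k
    have hsq : dWaveGap k ^ 2 ≤ 4 := by
      have := abs_le.mp hgk
      nlinarith
    rw [div_le_div_iff_of_pos_right hg]
    calc (2 * Real.sqrt 2 * dWaveGap k * h) ^ 2 = 8 * dWaveGap k ^ 2 * h ^ 2 := by ring_nf; rw [h2]; ring
      _ ≤ 8 * 4 * h ^ 2 := by gcongr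
      _ = 32 * h ^ 2 := by ring
  calc ∑ k : TorusSite 2 L, (2 * Real.sqrt 2 * dWaveGap k * h) ^ 2 / g
      ≤ ∑ _k : TorusSite 2 L, 32 * h ^ 2 / g := Finset.sum_le_sum fun k _ => hterm k
    _ = 32 * h ^ 2 / g * (L : ℝ) ^ 2 := by
      rw [Finset.sum_const, Finset.card_univ, card_torusSite_two, nsmul_eq_mul]
      push_cast
      ring

/-- (P4) The sourced pair modes complete to squares:
`g Σ_k b_k†b_k + h·[-(Δ_d + Δ_d†)] + (Σ_k a_k²/g) 1 = Σ_k g⁻¹ (g b_k + a_k)†(g b_k + a_k) ≥ 0`, `a_k = 2√2 ĝ_d(k) h`. -/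
theorem posSemidef_pairModes_source_shift {g : ℝ} (hg : 0 < g) (h : ℝ) :
    ((g : ℂ) • ∑ k : TorusSite 2 L, (pairMode k)ᴴ * pairMode k +
        (h : ℂ) • -(pairField dWaveFormFactor L + (pairField dWaveFormFactor L)ᴴ) +
        ((∑ k : TorusSite 2 L, (2 * Real.sqrt 2 * dWaveGap k * h) ^ 2 / g : ℝ) : ℂ) •
          (1 : Matrix (Finset (Orb (FermionTorus 2 L))) _ ℂ)).PosSemidef := by
  have hrepr : ((g : ℂ) • ∑ k : TorusSite 2 L, (pairMode k)ᴴ * pairMode k +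
        (h : ℂ) • -(pairField dWaveFormFactor L + (pairField dWaveFormFactor L)ᴴ) +
        ((∑ k : TorusSite 2 L, (2 * Real.sqrt 2 * dWaveGap k * h) ^ 2 / g : ℝ) : ℂ) •
          (1 : Matrix (Finset (Orb (FermionTorus 2 L))) _ ℂ)) =
      ∑ k : TorusSite 2 L, ((g : ℂ) • ((pairMode k)ᴴ * pairMode k) +
        ((2 * Real.sqrt 2 * dWaveGap k * h : ℝ) : ℂ) • (pairMode k + (pairMode k)ᴴ) +
        (((2 * Real.sqrt 2 * dWaveGap k * h) ^ 2 / g : ℝ) : ℂ) •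
          (1 : Matrix (Finset (Orb (FermionTorus 2 L))) _ ℂ)) := by
    rw [neg_pairField_add_conjTranspose_eq_sum]
    simp only [Finset.smul_sum, Finset.sum_add_distrib, smul_smul, ← Complex.ofReal_mul,
      Complex.ofReal_sum, Finset.sum_smul]
    refine congrArg₂ (· + ·) (congrArg₂ (· + ·) rfl (Finset.sum_congr rfl fun k _ => ?_)) rfl
    ring_nf
  rw [hrepr]
  exact posSemidef_sum _ fun k _ => posSemidef_pairMode_square k hg _

/-- **Below-band stability of the sourced torus.** For `L ≥ 3`, `U ≥ 0`, `μ < -4` and every real `h`: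
`H_{L,h} + c_L(h) · 1 ≥ 0`, `c_L(h) = Σ_k (2√2 ĝ_d(k) h)²/(-4-μ)` (sum of (P1)–(P4)). -/
theorem posSemidef_dWaveSourceTorus_add_shift (hL : 3 ≤ L) {U μ : ℝ} (hU : 0 ≤ U) (hμ : μ < -4)
    (h : ℝ) :
    (dWaveSourceTorus L U μ h +
        ((∑ k : TorusSite 2 L, (2 * Real.sqrt 2 * dWaveGap k * h) ^ 2 / (-4 - μ) : ℝ) : ℂ) •
          (1 : Matrix (Finset (Orb (FermionTorus 2 L))) _ ℂ)).PosSemidef := by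
  have hg : 0 < -4 - μ := by linarith
  have h1 := posSemidef_hubbardTorusWith_sub_free (L := L) hU μ
  have h2 := posSemidef_free_sub_gap_smul_totalNumber hL μ
  have h3 := posSemidef_ofReal_smul (posSemidef_totalNumber_sub_sum_pairMode (L := L)) hg.le
  have h4 := posSemidef_pairModes_source_shift (L := L) hg h
  have hsum := ((h1.add h2).add h3).add h4
  convert hsum using 1
  rw [dWaveSourceTorus_eq, smul_sub, smul_neg, sub_eq_add_neg]
  abel

/-- **Quadratic lower bound on the sourced ground energy below the band**: `-32 h² L²/(-4-μ) ≤ E₀(H_{L,h})`. -/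
theorem neg_le_groundEnergy_dWaveSourceTorus (hL : 3 ≤ L) {U μ : ℝ} (hU : 0 ≤ U) (hμ : μ < -4) (h : ℝ) :
    -(32 * h ^ 2 / (-4 - μ) * (L : ℝ) ^ 2) ≤ (dWaveSourceTorus L U μ h).groundEnergy := by
  have hg : 0 < -4 - μ := by linarith
  have hA : (dWaveSourceTorus L U μ h).IsHermitian :=
    dWaveSourceTorus_isHermitian L (isHermitian_hubbardTorusWith L 1 U μ) h
  have hpos := Matrix.groundStateFunctional_nonneg_of_posSemidef (dWaveSourceTorus L U μ h)
    (posSemidef_dWaveSourceTorus_add_shift hL hU hμ h)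
  rw [map_add, map_smul, Matrix.groundStateFunctional_hamiltonian hA,
    Matrix.groundStateFunctional_one hA] at hpos
  obtain ⟨hre, -⟩ := Complex.nonneg_iff.mp hpos
  simp only [Complex.add_re, Complex.ofReal_re, smul_eq_mul, mul_one] at hre
  have hc := sourceShift_le (L := L) hg h
  linarith

omit [NeZero L] in
/-- The vacuum is annihilated by the grand-canonical Hubbard Hamiltonian (every term ends in an annihilator). -/
theorem hubbardTorusWith_mulVec_vacuum (U μ : ℝ) :
    hubbardTorusWith 2 L 1 U μ *ᵥ (vacuum : Fock (Orb (FermionTorus 2 L))) = 0 := by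
  have hN : (totalNumber : Matrix (Finset (Orb (FermionTorus 2 L))) _ ℂ) *ᵥ
      (vacuum : Fock (Orb (FermionTorus 2 L))) = 0 := by
    have han : ∀ i : Orb (FermionTorus 2 L),
        annihilation i *ᵥ (vacuum : Fock (Orb (FermionTorus 2 L))) = 0 :=
      fun i => annihilation_mulVec_vacuum_holds i
    simp only [totalNumber, numberOp, Matrix.sum_mulVec, ← mulVec_mulVec, han, mulVec_zero,
      Finset.sum_const_zero]
  rw [hubbardTorusWith, hamiltonianWith, sub_mulVec, hamiltonian_mulVec_vacuum, smul_mulVec, hN,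
    smul_zero, sub_zero]

omit [NeZero L] in
/-- The source-free grand-canonical ground energy is non-positive at every `U, μ` (the vacuum is a trial state with
energy `0`). -/
theorem groundEnergy_hubbardTorusWith_le_zero (U μ : ℝ) :
    (hubbardTorusWith 2 L 1 U μ).groundEnergy ≤ 0 := by
  have hvac : star (vacuum : Fock (Orb (FermionTorus 2 L))) ⬝ᵥ vacuum = 1 := by
    simp [vacuum, dotProduct_single]
  have h := Matrix.groundEnergy_le_rayleigh_holds (isHermitian_hubbardTorusWith L 1 U μ) vacuum hvac
  rw [hubbardTorusWith_mulVec_vacuum, dotProduct_zero, Complex.zero_re] at h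
  exact h

/-- **Quadratic sourced energy gain below the band**: for `L ≥ 3`, `U ≥ 0`, `μ < -4` and every real `h`,
`E₀(H_{L,0}) - E₀(H_{L,h}) ≤ 32 h² L² / (-4 - μ)`. -/
theorem groundEnergy_gain_le_below_band (hL : 3 ≤ L) {U μ : ℝ} (hU : 0 ≤ U) (hμ : μ < -4) (h : ℝ) :
    (dWaveSourceTorus L U μ 0).groundEnergy - (dWaveSourceTorus L U μ h).groundEnergy ≤
      32 * h ^ 2 / (-4 - μ) * (L : ℝ) ^ 2 := by
  have h0 : (dWaveSourceTorus L U μ 0).groundEnergy ≤ 0 := by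
    rw [dWaveSourceTorus_zero]; exact groundEnergy_hubbardTorusWith_le_zero U μ
  have h1 := neg_le_groundEnergy_dWaveSourceTorus hL hU hμ h
  linarith

/-- **No Koma–Tasaki `d`-wave order below the band, at every repulsion**: `U ≥ 0`, `μ < -4` ⇒ `m(U,μ) = 0`. -/
theorem dWaveOrderParameter_eq_zero_below_band {U μ : ℝ} (hU : 0 ≤ U) (hμ : μ < -4) :
    dWaveOrderParameter U μ = 0 := by
  refine dWaveOrderParameter_eq_zero_of_sublinear_gain U μ (fun h => 32 * (2 * h) ^ 2 / (-4 - μ)) ?_ ?_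
  · have hcont : Tendsto (fun h : ℝ => 64 * h / (-4 - μ)) (𝓝[>] 0) (𝓝 0) := by
      have : Tendsto (fun h : ℝ => 64 * h / (-4 - μ)) (𝓝 0) (𝓝 (64 * 0 / (-4 - μ))) :=
        ((continuous_const.mul continuous_id).div_const _).tendsto 0
      rw [mul_zero, zero_div] at this
      exact this.mono_left nhdsWithin_le_nhds
    refine hcont.congr' ?_
    filter_upwards [self_mem_nhdsWithin] with h hh
    have hh' : (h : ℝ) ≠ 0 := ne_of_gt hh
    field_simp
    ring
  · filter_upwards [self_mem_nhdsWithin] with h _hh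
    filter_upwards [eventually_ge_atTop 2] with L hL2
    have hL3 : 3 ≤ L + 1 := by omega
    exact groundEnergy_gain_le_below_band hL3 hU hμ (2 * h)

/-- Hence `¬ HasDWaveOrder U μ` for every `U ≥ 0` and every `μ < -4`. -/
theorem not_hasDWaveOrder_below_band {U μ : ℝ} (hU : 0 ≤ U) (hμ : μ < -4) : ¬ HasDWaveOrder U μ := by
  rw [hasDWaveOrder_iff, dWaveOrderParameter_eq_zero_below_band hU hμ]
  exact lt_irrefl 0

/-- **The density conjunct ALSO fails below the band**: for `L ≥ 3`, `U ≥ 0`, `μ < -4` the grand-canonical tracial density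
is identically `0` (`ω(K_U - gN) ≥ 0`, `ω(K_U) = E₀ ≤ 0`, `ω(N) ≥ 0`, `g > 0`). -/
theorem re_groundStateFunctional_totalNumber_eq_zero (hL : 3 ≤ L) {U μ : ℝ} (hU : 0 ≤ U) (hμ : μ < -4) :
    ((hubbardTorusWith 2 L 1 U μ).groundStateFunctional totalNumber).re = 0 := by
  have hg : 0 < -4 - μ := by linarith
  have hA := isHermitian_hubbardTorusWith L 1 U μ
  have hKN : (hubbardTorusWith 2 L 1 U μ - (((-4 - μ : ℝ)) : ℂ) • totalNumber).PosSemidef := by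
    have := (posSemidef_hubbardTorusWith_sub_free (L := L) hU μ).add (posSemidef_free_sub_gap_smul_totalNumber hL μ)
    rwa [sub_add_sub_cancel] at this
  have hpos := Matrix.groundStateFunctional_nonneg_of_posSemidef (hubbardTorusWith 2 L 1 U μ) hKN
  rw [map_sub, map_smul, Matrix.groundStateFunctional_hamiltonian hA] at hpos
  obtain ⟨hre, -⟩ := Complex.nonneg_iff.mp hpos
  simp only [Complex.sub_re, Complex.ofReal_re, smul_eq_mul, Complex.mul_re, Complex.ofReal_im, zero_mul,
    sub_zero] at hre
  have hE := groundEnergy_hubbardTorusWith_le_zero (L := L) U μ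
  have hN := Matrix.groundStateFunctional_nonneg_of_posSemidef (hubbardTorusWith 2 L 1 U μ)
    (posSemidef_totalNumber (Λ := FermionTorus 2 L))
  obtain ⟨hNre, -⟩ := Complex.nonneg_iff.mp hN
  nlinarith

end BelowBand

/-! ### §5b Above the band: the particle–hole twin (cycle 1, second half)

Same statements and proofs as part 2 of the filed support files
(`Theorems/FixedPointDWaveOrder/Negative/AboveBandNoOrder.lean`). -/

section TorusP1

variable {L : ℕ}

/-- `(c†_{x↑}c†_{x↓})†(c†_{x↑}c†_{x↓}) = (1 - n_{x↑})(1 - n_{x↓}) = 1 - n_{x↓} - n_{x↑} + n_{x↑}n_{x↓}` (CAR). [folklore] -/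
theorem pairCreation_sq_eq (x : FermionTorus 2 L) :
    (creation (orb x 0) * creation (orb x 1))ᴴ * (creation (orb x 0) * creation (orb x 1)) =
      (1 : Matrix (Finset (Orb (FermionTorus 2 L))) _ ℂ) - numberOp x 1 - numberOp x 0 + numberOp x 0 * numberOp x 1 := by
  have h00 : annihilation (orb x (0 : Fin 2)) * creation (orb x 0) =
      (1 : Matrix (Finset (Orb (FermionTorus 2 L))) _ ℂ) - numberOp x 0 := by
    have h := annihilation_mul_creation_add_torus (d := 2) (L := L) (orb x 0) (orb x 0)
    rw [if_pos rfl] at h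
    rw [numberOp, ← h]; abel
  have h11 : annihilation (orb x (1 : Fin 2)) * creation (orb x 1) =
      (1 : Matrix (Finset (Orb (FermionTorus 2 L))) _ ℂ) - numberOp x 1 := by
    have h := annihilation_mul_creation_add_torus (d := 2) (L := L) (orb x 1) (orb x 1)
    rw [if_pos rfl] at h
    rw [numberOp, ← h]; abel
  have hcomm : numberOp x (0 : Fin 2) * annihilation (orb x 1) = annihilation (orb x 1) * numberOp x 0 := by
    have := numberOp_commutator_annihilation x x (0 : Fin 2) 1
    simpa [sub_eq_zero] using this
  rw [conjTranspose_mul, creation_conjTranspose, creation_conjTranspose, Matrix.mul_assoc,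
    ← Matrix.mul_assoc (annihilation (orb x 0)), h00, Matrix.sub_mul, Matrix.one_mul, Matrix.mul_sub,
    ← Matrix.mul_assoc (annihilation (orb x 1)) (numberOp x 0), ← hcomm, Matrix.mul_assoc, h11,
    Matrix.mul_sub, Matrix.mul_one]
  abel

/-- **(P1⁺) Holes destroy at most one doublon each**: `Σ_x n_{x↑}n_{x↓} + L²·1 - N = Σ_x (1-n_{x↑})(1-n_{x↓}) ≥ 0`. [folklore] -/
theorem posSemidef_doubleOcc_add_card_sub_totalNumber :
    (∑ x : FermionTorus 2 L, numberOp x 0 * numberOp x 1 +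
        ((Fintype.card (FermionTorus 2 L) : ℕ) : ℂ) • (1 : Matrix (Finset (Orb (FermionTorus 2 L))) _ ℂ) -
        totalNumber).PosSemidef := by
  have hrepr : (∑ x : FermionTorus 2 L, numberOp x 0 * numberOp x 1 +
        ((Fintype.card (FermionTorus 2 L) : ℕ) : ℂ) • (1 : Matrix (Finset (Orb (FermionTorus 2 L))) _ ℂ) -
        totalNumber) =
      ∑ x : FermionTorus 2 L, (creation (orb x 0) * creation (orb x 1))ᴴ * (creation (orb x 0) * creation (orb x 1)) := by
    simp only [pairCreation_sq_eq, Finset.sum_add_distrib, Finset.sum_sub_distrib, Finset.sum_const, Finset.card_univ,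
      totalNumber, Fin.sum_univ_two, Nat.cast_smul_eq_nsmul]
    abel
  rw [hrepr]
  exact posSemidef_sum _ fun x _ => posSemidef_conjTranspose_mul_self _

end TorusP1


/-! #### Momentum space: holes, pair modes, the four pieces above the band -/

section AboveBandMomentum
variable {L : ℕ} [NeZero L]

/-- Hole number of a Bloch mode: `c_{kσ} c†_{kσ} = 1 - n_{kσ}` (CAR). [folklore] -/
theorem momentumAnnihilation_mul_momentumCreation_self (k : TorusSite 2 L) (σ : Fin 2) :
    momentumAnnihilation k σ * momentumCreation k σ = 1 - momentumNumber k σ := by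
  rw [momentumAnnihilation_mul_momentumCreation, momentumNumber]
  simp

/-- `c_{kσ} c†_{kσ} ≥ 0`. [folklore] -/
theorem posSemidef_hole (k : TorusSite 2 L) (σ : Fin 2) :
    (momentumAnnihilation k σ * momentumCreation k σ).PosSemidef := by
  have h : momentumAnnihilation k σ * momentumCreation k σ = (momentumCreation k σ)ᴴ * momentumCreation k σ := by
    rw [momentumCreation_conjTranspose]
  rw [h]
  exact posSemidef_conjTranspose_mul_self _

/-- The momentum-space hole count is `2L² - N`: `Σ_{kσ} c_{kσ}c†_{kσ} = 2L²·1 - N` (Parseval). [folklore] -/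
theorem sum_hole_eq :
    ∑ k : TorusSite 2 L, ∑ σ : Fin 2, momentumAnnihilation k σ * momentumCreation k σ =
      ((2 * L ^ 2 : ℕ) : ℂ) • (1 : Matrix (Finset (Orb (FermionTorus 2 L))) _ ℂ) - totalNumber := by
  simp only [momentumAnnihilation_mul_momentumCreation_self, Finset.sum_sub_distrib, totalNumber_eq_sum_momentumNumber]
  congr 1
  rw [Finset.sum_const, Finset.card_univ, Finset.sum_const, Finset.card_univ, card_torusSite_two, Fintype.card_fin,
    smul_smul, ← Nat.cast_smul_eq_nsmul ℂ]
  push_cast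
  ring_nf

/-- `n̄_{-k↓} - b_k b_k† = Z†Z` with `Z = c_{k↑} c†_{-k↓}` (CAR `c†_{k↑}c_{k↑} = 1 - c_{k↑}c†_{k↑}`). [folklore] -/
theorem hole_sub_pairMode_mul_conjTranspose (k : TorusSite 2 L) :
    momentumAnnihilation (-k) 1 * momentumCreation (-k) 1 - pairMode k * (pairMode k)ᴴ =
      (momentumAnnihilation k 0 * momentumCreation (-k) 1)ᴴ * (momentumAnnihilation k 0 * momentumCreation (-k) 1) := by
  have hn : momentumCreation k (0 : Fin 2) * momentumAnnihilation k 0 =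
      1 - momentumAnnihilation k 0 * momentumCreation k 0 := by
    rw [momentumAnnihilation_mul_momentumCreation_self (L := L) k 0, momentumNumber]
    abel
  rw [pairMode_conjTranspose, pairMode, conjTranspose_mul, momentumCreation_conjTranspose,
    momentumAnnihilation_conjTranspose]
  -- LHS: c_B c_B† - c_B c_A c_A† c_B† ; RHS: c_B c_A† c_A c_B†  with c_A = c_{k↑}, c_B = c_{-k↓}
  rw [Matrix.mul_assoc (momentumAnnihilation (-k) 1) (momentumCreation k 0),
    ← Matrix.mul_assoc (momentumCreation k 0), hn]
  simp only [Matrix.sub_mul, Matrix.one_mul, Matrix.mul_sub, Matrix.mul_assoc]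

/-- `b_k b_k† ≤ c_{-k↓}c†_{-k↓}` as operators. [folklore] -/
theorem posSemidef_hole_sub_pairMode_mul_conjTranspose (k : TorusSite 2 L) :
    (momentumAnnihilation (-k) 1 * momentumCreation (-k) 1 - pairMode k * (pairMode k)ᴴ).PosSemidef := by
  rw [hole_sub_pairMode_mul_conjTranspose]
  exact posSemidef_conjTranspose_mul_self _

/-- **(P3⁺)** `(2L²·1 - N) - Σ_k b_k b_k† ≥ 0`. [folklore] -/
theorem posSemidef_holes_sub_sum_pairMode_mul_conjTranspose :
    ((((2 * L ^ 2 : ℕ) : ℂ) • (1 : Matrix (Finset (Orb (FermionTorus 2 L))) _ ℂ) - totalNumber) -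
        ∑ k : TorusSite 2 L, pairMode k * (pairMode k)ᴴ).PosSemidef := by
  have hneg : ∑ k : TorusSite 2 L, momentumAnnihilation (-k) (1 : Fin 2) * momentumCreation (-k) 1 =
      ∑ k : TorusSite 2 L, momentumAnnihilation k (1 : Fin 2) * momentumCreation k 1 :=
    Equiv.sum_comp (Equiv.neg (TorusSite 2 L)) (fun k => momentumAnnihilation k (1 : Fin 2) * momentumCreation k 1)
  have hrepr : ((((2 * L ^ 2 : ℕ) : ℂ) • (1 : Matrix (Finset (Orb (FermionTorus 2 L))) _ ℂ) - totalNumber) -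
        ∑ k : TorusSite 2 L, pairMode k * (pairMode k)ᴴ) =
      ∑ k : TorusSite 2 L, (momentumAnnihilation (-k) 1 * momentumCreation (-k) 1 - pairMode k * (pairMode k)ᴴ) +
        ∑ k : TorusSite 2 L, momentumAnnihilation k 0 * momentumCreation k 0 := by
    rw [← sum_hole_eq, Finset.sum_sub_distrib, hneg]
    simp only [Fin.sum_univ_two, Finset.sum_add_distrib]
    abel
  rw [hrepr]
  exact (posSemidef_sum _ fun k _ => posSemidef_hole_sub_pairMode_mul_conjTranspose k).add
    (posSemidef_sum _ fun k _ => posSemidef_hole k 0)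

/-- **(P2⁺)** Above the band the free grand-canonical Hamiltonian dominates the holes:
`K_0 - C_L(μ)·1 - (μ - 4)(2L²·1 - N) = Σ_{kσ} (4 - ε_k) c_{kσ}c†_{kσ} ≥ 0`, `C_L(μ) = Σ_{kσ}(ε_k - μ)` (`L ≥ 3`). [folklore] -/
theorem posSemidef_free_sub_const_sub_holes (hL : 3 ≤ L) (μ : ℝ) :
    (hubbardTorusWith 2 L 1 0 μ -
        ((Finset.univ.sum fun k : TorusSite 2 L => ∑ _σ : Fin 2, (torusBand L k - μ) : ℝ) : ℂ) • (1 : Matrix (Finset (Orb (FermionTorus 2 L))) _ ℂ) -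
        ((μ - 4 : ℝ) : ℂ) • ((((2 * L ^ 2 : ℕ) : ℂ) • (1 : Matrix (Finset (Orb (FermionTorus 2 L))) _ ℂ) - totalNumber))).PosSemidef := by
  rw [← sum_hole_eq, hubbardTorusWith_zero_eq_sum_momentumNumber hL μ]
  have hrepr : (∑ k : TorusSite 2 L, ∑ σ : Fin 2, ((torusBand L k - μ : ℝ) : ℂ) • momentumNumber k σ -
        ((Finset.univ.sum fun k : TorusSite 2 L => ∑ _σ : Fin 2, (torusBand L k - μ) : ℝ) : ℂ) •
          (1 : Matrix (Finset (Orb (FermionTorus 2 L))) _ ℂ) -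
        ((μ - 4 : ℝ) : ℂ) • ∑ k : TorusSite 2 L, ∑ σ : Fin 2, momentumAnnihilation k σ * momentumCreation k σ) =
      ∑ k : TorusSite 2 L, ∑ σ : Fin 2, ((4 - torusBand L k : ℝ) : ℂ) • (momentumAnnihilation k σ * momentumCreation k σ) := by
    simp only [Complex.ofReal_sum, Finset.sum_smul, Finset.smul_sum, ← Finset.sum_sub_distrib]
    refine Finset.sum_congr rfl fun k _ => Finset.sum_congr rfl fun σ _ => ?_
    rw [momentumAnnihilation_mul_momentumCreation_self]
    push_cast
    module
  rw [hrepr]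
  refine posSemidef_sum _ fun k _ => posSemidef_sum _ fun σ _ => posSemidef_ofReal_smul (posSemidef_hole k σ) ?_
  have := torusBand_le_four L k
  linarith

/-- The completed square of a sourced pair mode, hole version: for real `s ≠ 0`, `a`,
`s b b† + a (b + b†) + (a²/s) 1 = s⁻¹ (s b† + a 1)†(s b† + a 1)`. [folklore] -/
theorem pairMode_square_identity' (k : TorusSite 2 L) {s : ℝ} (hs : s ≠ 0) (a : ℝ) :
    (s : ℂ) • (pairMode k * (pairMode k)ᴴ) + (a : ℂ) • (pairMode k + (pairMode k)ᴴ) +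
        ((a ^ 2 / s : ℝ) : ℂ) • (1 : Matrix (Finset (Orb (FermionTorus 2 L))) _ ℂ) =
      ((s⁻¹ : ℝ) : ℂ) • (((s : ℂ) • (pairMode k)ᴴ + (a : ℂ) • 1)ᴴ * ((s : ℂ) • (pairMode k)ᴴ + (a : ℂ) • 1)) := by
  have hs' : (s : ℂ) ≠ 0 := Complex.ofReal_ne_zero.mpr hs
  simp only [conjTranspose_add, conjTranspose_smul, conjTranspose_one, conjTranspose_conjTranspose, Complex.star_def,
    Complex.conj_ofReal, Matrix.add_mul, Matrix.mul_add, Matrix.smul_mul, Matrix.mul_smul,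
    Matrix.one_mul, Matrix.mul_one, smul_add, smul_smul]
  push_cast
  field_simp
  module

/-- **(P4⁺)** `s Σ_k b_k b_k† + h·[-(Δ_d + Δ_d†)] + (Σ_k a_k²/s) 1 = Σ_k s⁻¹ (s b_k† + a_k)†(s b_k† + a_k) ≥ 0`. [folklore] -/
theorem posSemidef_pairModes_source_shift' {s : ℝ} (hs : 0 < s) (h : ℝ) :
    ((s : ℂ) • ∑ k : TorusSite 2 L, pairMode k * (pairMode k)ᴴ +
        (h : ℂ) • -(pairField dWaveFormFactor L + (pairField dWaveFormFactor L)ᴴ) +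
        ((∑ k : TorusSite 2 L, (2 * Real.sqrt 2 * dWaveGap k * h) ^ 2 / s : ℝ) : ℂ) •
          (1 : Matrix (Finset (Orb (FermionTorus 2 L))) _ ℂ)).PosSemidef := by
  have hrepr : ((s : ℂ) • ∑ k : TorusSite 2 L, pairMode k * (pairMode k)ᴴ +
        (h : ℂ) • -(pairField dWaveFormFactor L + (pairField dWaveFormFactor L)ᴴ) +
        ((∑ k : TorusSite 2 L, (2 * Real.sqrt 2 * dWaveGap k * h) ^ 2 / s : ℝ) : ℂ) •
          (1 : Matrix (Finset (Orb (FermionTorus 2 L))) _ ℂ)) =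
      ∑ k : TorusSite 2 L, ((s : ℂ) • (pairMode k * (pairMode k)ᴴ) +
        ((2 * Real.sqrt 2 * dWaveGap k * h : ℝ) : ℂ) • (pairMode k + (pairMode k)ᴴ) +
        (((2 * Real.sqrt 2 * dWaveGap k * h) ^ 2 / s : ℝ) : ℂ) •
          (1 : Matrix (Finset (Orb (FermionTorus 2 L))) _ ℂ)) := by
    rw [neg_pairField_add_conjTranspose_eq_sum]
    simp only [Finset.smul_sum, Finset.sum_add_distrib, smul_smul, ← Complex.ofReal_mul,
      Complex.ofReal_sum, Finset.sum_smul]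
    refine congrArg₂ (· + ·) (congrArg₂ (· + ·) rfl (Finset.sum_congr rfl fun k _ => ?_)) rfl
    ring_nf
  rw [hrepr]
  refine posSemidef_sum _ fun k _ => ?_
  rw [pairMode_square_identity' k hs.ne' _]
  exact posSemidef_ofReal_smul (posSemidef_conjTranspose_mul_self _) (inv_nonneg.mpr hs.le)

/-! #### Assembly above the band -/

/-- **Above-band stability of the sourced torus.** For `L ≥ 3`, `U ≥ 0`, `μ > 4 + U` and every real `h`:
`H_{L,h} - (C_L(μ) + U L² - c_L(h))·1 ≥ 0`, `c_L(h) = Σ_k (2√2 ĝ_d(k) h)²/(μ - 4 - U)`. [cite: KomaTasaki1994, §1] -/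
theorem posSemidef_dWaveSourceTorus_sub_shift_above (hL : 3 ≤ L) {U μ : ℝ} (hU : 0 ≤ U) (hμ : 4 + U < μ) (h : ℝ) :
    (dWaveSourceTorus L U μ h -
        (((Finset.univ.sum fun k : TorusSite 2 L => ∑ _σ : Fin 2, (torusBand L k - μ)) + U * (L : ℝ) ^ 2 -
            (Finset.univ.sum fun k : TorusSite 2 L => (2 * Real.sqrt 2 * dWaveGap k * h) ^ 2 / (μ - 4 - U)) : ℝ) : ℂ) •
          (1 : Matrix (Finset (Orb (FermionTorus 2 L))) _ ℂ)).PosSemidef := by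
  have hs : 0 < μ - 4 - U := by linarith
  -- (P1⁺), multiplied by U and combined with K_U - K_0 = U·D
  have h1 : (hubbardTorusWith 2 L 1 U μ - hubbardTorusWith 2 L 1 0 μ +
      (U : ℂ) • ((((Fintype.card (FermionTorus 2 L) : ℕ) : ℂ)) • (1 : Matrix (Finset (Orb (FermionTorus 2 L))) _ ℂ) -
        totalNumber)).PosSemidef := by
    have hP := posSemidef_ofReal_smul (posSemidef_doubleOcc_add_card_sub_totalNumber (L := L)) hU
    convert hP using 1
    rw [hubbardTorusWith, hubbardTorusWith, hamiltonianWith_sub_hamiltonianWith, sub_zero]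
    simp only [smul_add, smul_sub]
    abel
  have hcard : (Fintype.card (FermionTorus 2 L) : ℕ) = L ^ 2 := by
    rw [Fintype.card_congr FermionTorus.equivTorusSite, card_torusSite_two]
  rw [hcard] at h1
  have h2 := posSemidef_free_sub_const_sub_holes hL μ
  have h3 := posSemidef_ofReal_smul (posSemidef_holes_sub_sum_pairMode_mul_conjTranspose (L := L)) hs.le
  have h4 := posSemidef_pairModes_source_shift' (L := L) hs h
  have hsum := ((h1.add h2).add h3).add h4
  convert hsum using 1
  rw [dWaveSourceTorus_eq]
  set C : ℝ := (Finset.univ.sum fun k : TorusSite 2 L => ∑ _σ : Fin 2, (torusBand L k - μ)) with hC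
  set c : ℝ := (Finset.univ.sum fun k : TorusSite 2 L => (2 * Real.sqrt 2 * dWaveGap k * h) ^ 2 / (μ - 4 - U)) with hc
  set KU := hubbardTorusWith 2 L 1 U μ
  set K0 := hubbardTorusWith 2 L 1 0 μ
  set N : Matrix (Finset (Orb (FermionTorus 2 L))) (Finset (Orb (FermionTorus 2 L))) ℂ := totalNumber
  set B := ∑ k : TorusSite 2 L, pairMode k * (pairMode k)ᴴ
  set O := pairField dWaveFormFactor L + (pairField dWaveFormFactor L)ᴴ
  simp only [smul_sub, smul_neg, smul_smul]
  push_cast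
  module

/-- **The filled state bounds the source-free ground energy above**: `E₀(K_U) ≤ C_L(μ) + U L²`
(`K_0|full⟩ = C_L(μ)|full⟩` since every hole operator kills `|full⟩`, and `D ≤ |Λ|`). [folklore] -/
theorem groundEnergy_hubbardTorusWith_le_const (hL : 3 ≤ L) {U : ℝ} (hU : 0 ≤ U) (μ : ℝ) :
    (hubbardTorusWith 2 L 1 U μ).groundEnergy ≤
      (∑ k : TorusSite 2 L, ∑ _σ : Fin 2, (torusBand L k - μ)) + U * (L : ℝ) ^ 2 := by
  set ψ : Fock (Orb (FermionTorus 2 L)) := Pi.single (Finset.univ : Finset (Orb (FermionTorus 2 L))) (1:ℂ) with hψ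
  have hunit : star ψ ⬝ᵥ ψ = 1 := by
    rw [hψ]; simp [dotProduct_single]
  have hfull : ∀ i : Orb (FermionTorus 2 L), creation i *ᵥ ψ = 0 := fun i => by
    have h := FermionOperatorsProofs.creation_mulVec_single i (Finset.univ : Finset (Orb (FermionTorus 2 L)))
    rw [if_pos (Finset.mem_univ i)] at h
    rw [hψ]
    convert h
  have hE := Matrix.groundEnergy_le_rayleigh_holds (isHermitian_hubbardTorusWith L 1 U μ) ψ hunit
  refine hE.trans ?_
  -- K_U = K_0 + U·D
  have hKU : hubbardTorusWith 2 L 1 U μ = hubbardTorusWith 2 L 1 0 μ +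
      (U : ℂ) • ∑ x : FermionTorus 2 L, numberOp x 0 * numberOp x 1 := by
    have := hamiltonianWith_sub_hamiltonianWith (fermionTorusGraph 2 L) 1 0 U μ
    rw [sub_zero] at this
    rw [hubbardTorusWith, hubbardTorusWith, ← this]
    abel
  -- holes kill the filled state
  have hcr : ∀ (k : TorusSite 2 L) (σ : Fin 2), momentumCreation k σ *ᵥ ψ = 0 := by
    intro k σ
    rw [momentumCreation_eq_sum, Matrix.sum_mulVec]
    refine Finset.sum_eq_zero fun x _ => ?_
    rw [smul_mulVec, hfull, smul_zero]
  have hK0 : hubbardTorusWith 2 L 1 0 μ *ᵥ ψ =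
      ((Finset.univ.sum fun k : TorusSite 2 L => ∑ _σ : Fin 2, (torusBand L k - μ) : ℝ) : ℂ) • ψ := by
    rw [hubbardTorusWith_zero_eq_sum_momentumNumber hL μ, Matrix.sum_mulVec, Complex.ofReal_sum, Finset.sum_smul]
    refine Finset.sum_congr rfl fun k _ => ?_
    rw [Matrix.sum_mulVec, Complex.ofReal_sum, Finset.sum_smul]
    refine Finset.sum_congr rfl fun σ _ => ?_
    have hn : momentumNumber k σ = 1 - momentumAnnihilation k σ * momentumCreation k σ := by
      rw [momentumAnnihilation_mul_momentumCreation_self]; abel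
    rw [smul_mulVec, hn, sub_mulVec, one_mulVec, ← mulVec_mulVec, hcr, mulVec_zero, sub_zero]
  have hD : (star ψ ⬝ᵥ ((∑ x : FermionTorus 2 L, numberOp x 0 * numberOp x 1) *ᵥ ψ)).re ≤ (L : ℝ) ^ 2 := by
    have hPSD : ((((Fintype.card (FermionTorus 2 L) : ℕ) : ℂ)) •
          (1 : Matrix (Finset (Orb (FermionTorus 2 L))) (Finset (Orb (FermionTorus 2 L))) ℂ) -
        ∑ x : FermionTorus 2 L, numberOp x 0 * numberOp x 1).PosSemidef := by
      convert posSemidef_card_sub_sum_numberOp_mul_numberOp (Λ := FermionTorus 2 L)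
    have hP := hPSD.dotProduct_mulVec_nonneg ψ
    rw [sub_mulVec, dotProduct_sub, smul_mulVec, one_mulVec, dotProduct_smul, hunit] at hP
    obtain ⟨hre, -⟩ := Complex.nonneg_iff.mp hP
    simp only [Complex.sub_re, smul_eq_mul, mul_one, Complex.natCast_re] at hre
    have hcard : (Fintype.card (FermionTorus 2 L) : ℝ) = (L : ℝ) ^ 2 := by
      rw [Fintype.card_congr FermionTorus.equivTorusSite, card_torusSite_two]; push_cast; ring
    linarith
  rw [hKU, add_mulVec, dotProduct_add, hK0, dotProduct_smul, hunit, smul_mulVec, dotProduct_smul, Complex.add_re]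
  simp only [smul_eq_mul, mul_one, Complex.ofReal_re, Complex.mul_re, Complex.ofReal_im, zero_mul, sub_zero]
  nlinarith

/-- **Quadratic sourced energy gain above the band**: for `L ≥ 3`, `U ≥ 0`, `μ > 4 + U` and every real `h`,
`E₀(H_{L,0}) - E₀(H_{L,h}) ≤ 32 h² L² / (μ - 4 - U)`. [cite: KomaTasaki1994, §1] -/
theorem groundEnergy_gain_le_above_band (hL : 3 ≤ L) {U μ : ℝ} (hU : 0 ≤ U) (hμ : 4 + U < μ) (h : ℝ) :
    (dWaveSourceTorus L U μ 0).groundEnergy - (dWaveSourceTorus L U μ h).groundEnergy ≤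
      32 * h ^ 2 / (μ - 4 - U) * (L : ℝ) ^ 2 := by
  have hs : 0 < μ - 4 - U := by linarith
  have hA : (dWaveSourceTorus L U μ h).IsHermitian :=
    dWaveSourceTorus_isHermitian L (isHermitian_hubbardTorusWith L 1 U μ) h
  have hpos := Matrix.groundStateFunctional_nonneg_of_posSemidef (dWaveSourceTorus L U μ h)
    (posSemidef_dWaveSourceTorus_sub_shift_above hL hU hμ h)
  rw [map_sub, map_smul, Matrix.groundStateFunctional_hamiltonian hA,
    Matrix.groundStateFunctional_one hA] at hpos
  obtain ⟨hre, -⟩ := Complex.nonneg_iff.mp hpos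
  simp only [Complex.sub_re, Complex.ofReal_re, smul_eq_mul, mul_one] at hre
  have h0 : (dWaveSourceTorus L U μ 0).groundEnergy ≤
      (∑ k : TorusSite 2 L, ∑ _σ : Fin 2, (torusBand L k - μ)) + U * (L : ℝ) ^ 2 := by
    rw [dWaveSourceTorus_zero]; exact groundEnergy_hubbardTorusWith_le_const hL hU μ
  have hc := sourceShift_le (L := L) hs h
  linarith

/-- **No Koma–Tasaki `d`-wave order above the band**: `U ≥ 0`, `μ > 4 + U` ⇒ `m(U,μ) = 0`. [cite: KomaTasaki1994, §1] -/
theorem dWaveOrderParameter_eq_zero_above_band {U μ : ℝ} (hU : 0 ≤ U) (hμ : 4 + U < μ) :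
    dWaveOrderParameter U μ = 0 := by
  refine dWaveOrderParameter_eq_zero_of_sublinear_gain U μ (fun h => 32 * (2 * h) ^ 2 / (μ - 4 - U)) ?_ ?_
  · have hcont : Tendsto (fun h : ℝ => 64 * h / (μ - 4 - U)) (𝓝[>] 0) (𝓝 0) := by
      have : Tendsto (fun h : ℝ => 64 * h / (μ - 4 - U)) (𝓝 0) (𝓝 (64 * 0 / (μ - 4 - U))) :=
        ((continuous_const.mul continuous_id).div_const _).tendsto 0
      rw [mul_zero, zero_div] at this
      exact this.mono_left nhdsWithin_le_nhds
    refine hcont.congr' ?_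
    filter_upwards [self_mem_nhdsWithin] with h hh
    have hh' : (h : ℝ) ≠ 0 := ne_of_gt hh
    field_simp
    ring
  · filter_upwards [self_mem_nhdsWithin] with h _hh
    filter_upwards [eventually_ge_atTop 2] with L hL2
    have hL3 : 3 ≤ L + 1 := by omega
    exact groundEnergy_gain_le_above_band hL3 hU hμ (2 * h)

/-- Hence `¬ HasDWaveOrder U μ` for every `U ≥ 0` and every `μ > 4 + U`. [cite: KomaTasaki1994, §1] -/
theorem not_hasDWaveOrder_above_band {U μ : ℝ} (hU : 0 ≤ U) (hμ : 4 + U < μ) : ¬ HasDWaveOrder U μ := by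
  rw [hasDWaveOrder_iff, dWaveOrderParameter_eq_zero_above_band hU hμ]
  exact lt_irrefl 0


/-! #### The density conjunct above the band -/

/-- **Above the band the grand-canonical tracial density is identically `2`** (`L ≥ 3`, `U ≥ 0`, `μ > 4 + U`):
`Re ω(N) = 2L²` — the hole count vanishes (`ω(K_U) - (C + UL²) - s·ω(N̄) ≥ 0`, `ω(K_U) = E₀ ≤ C + UL²`, `ω(N̄) ≥ 0`). [folklore] -/
theorem re_groundStateFunctional_totalNumber_eq_two_mul (hL : 3 ≤ L) {U μ : ℝ} (hU : 0 ≤ U) (hμ : 4 + U < μ) :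
    ((hubbardTorusWith 2 L 1 U μ).groundStateFunctional totalNumber).re = 2 * (L : ℝ) ^ 2 := by
  have hs : 0 < μ - 4 - U := by linarith
  have hA := isHermitian_hubbardTorusWith L 1 U μ
  -- the hole operator in position form and its positivity (momentum form)
  have hholes : (((2 * L ^ 2 : ℕ) : ℂ) • (1 : Matrix (Finset (Orb (FermionTorus 2 L))) _ ℂ) - totalNumber).PosSemidef := by
    rw [← sum_hole_eq]
    exact posSemidef_sum _ fun k _ => posSemidef_sum _ fun σ _ => posSemidef_hole k σ
  -- K_U - (C + U L²)·1 - s·N̄ ≥ 0 from (P1⁺) + (P2⁺)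
  have h1 : (hubbardTorusWith 2 L 1 U μ - hubbardTorusWith 2 L 1 0 μ +
      (U : ℂ) • ((((L ^ 2 : ℕ) : ℂ)) • (1 : Matrix (Finset (Orb (FermionTorus 2 L))) _ ℂ) - totalNumber)).PosSemidef := by
    have hP := posSemidef_ofReal_smul (posSemidef_doubleOcc_add_card_sub_totalNumber (L := L)) hU
    have hcard : (Fintype.card (FermionTorus 2 L) : ℕ) = L ^ 2 := by
      rw [Fintype.card_congr FermionTorus.equivTorusSite, card_torusSite_two]
    rw [hcard] at hP
    convert hP using 1
    rw [hubbardTorusWith, hubbardTorusWith, hamiltonianWith_sub_hamiltonianWith, sub_zero]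
    simp only [smul_add, smul_sub]
    abel
  have h2 := posSemidef_free_sub_const_sub_holes hL μ
  have hKN : (hubbardTorusWith 2 L 1 U μ -
      (((Finset.univ.sum fun k : TorusSite 2 L => ∑ _σ : Fin 2, (torusBand L k - μ)) + U * (L : ℝ) ^ 2 : ℝ) : ℂ) •
        (1 : Matrix (Finset (Orb (FermionTorus 2 L))) _ ℂ) -
      ((μ - 4 - U : ℝ) : ℂ) • (((2 * L ^ 2 : ℕ) : ℂ) • (1 : Matrix (Finset (Orb (FermionTorus 2 L))) _ ℂ) - totalNumber)).PosSemidef := by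
    convert h1.add h2 using 1
    set C : ℝ := (Finset.univ.sum fun k : TorusSite 2 L => ∑ _σ : Fin 2, (torusBand L k - μ)) with hC
    simp only [smul_sub, smul_smul]
    push_cast
    module
  have hpos := Matrix.groundStateFunctional_nonneg_of_posSemidef (hubbardTorusWith 2 L 1 U μ) hKN
  rw [map_sub, map_sub, map_smul, map_smul, map_sub, map_smul, Matrix.groundStateFunctional_hamiltonian hA,
    Matrix.groundStateFunctional_one hA] at hpos
  obtain ⟨hre, -⟩ := Complex.nonneg_iff.mp hpos
  simp only [Complex.sub_re, Complex.ofReal_re, smul_eq_mul, mul_one, Complex.mul_re, Complex.ofReal_im, zero_mul,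
    sub_zero, Complex.natCast_re] at hre
  have hE := groundEnergy_hubbardTorusWith_le_const hL hU μ
  have hN := Matrix.groundStateFunctional_nonneg_of_posSemidef (hubbardTorusWith 2 L 1 U μ) hholes
  rw [map_sub, map_smul, Matrix.groundStateFunctional_one hA] at hN
  obtain ⟨hNre, -⟩ := Complex.nonneg_iff.mp hN
  simp only [Complex.sub_re, smul_eq_mul, mul_one, Complex.natCast_re] at hNre
  push_cast at hre hNre
  nlinarith


end AboveBandMomentum

/-- **The band window.** At every repulsion `U ≥ 0`, Koma–Tasaki `d`-wave order forces `μ ∈ [-4, 4 + U]`. -/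
theorem mem_band_window_of_hasDWaveOrder {U μ : ℝ} (hU : 0 ≤ U) (h : HasDWaveOrder U μ) :
    μ ∈ Icc (-4:ℝ) (4 + U) := by
  by_contra hμ
  rw [Set.mem_Icc, not_and_or, not_le, not_le] at hμ
  rcases hμ with hμ | hμ
  · exact not_hasDWaveOrder_below_band hU hμ h
  · exact not_hasDWaveOrder_above_band hU hμ h

/-- **Load-bearing reading, both sides**: with the density clause dropped, the `μ`-witness of the crux lies in
`[-4, 4+U] ⊆ [-4, 7]` on the box. -/
theorem not_cruxWithoutDensity_off_band :
    ¬ ∃ U ∈ Icc (2:ℝ) 3, ∃ μ : ℝ, μ ∉ Icc (-4:ℝ) (4 + U) ∧ HasDWaveOrder U μ := by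
  rintro ⟨U, hU, μ, hμ, hord⟩
  exact hμ (mem_band_window_of_hasDWaveOrder (by linarith [hU.1]) hord)

/-- `CruxWithoutDensity` is equivalent to its band-window restriction (the off-band part is provably empty). -/
theorem cruxWithoutDensity_iff_inWindow :
    CruxWithoutDensity ↔ ∃ U ∈ Icc (2:ℝ) 3, ∃ μ ∈ Icc (-4:ℝ) (4 + U), HasDWaveOrder U μ := by
  constructor
  · rintro ⟨U, hU, μ, hord⟩
    exact ⟨U, hU, μ, mem_band_window_of_hasDWaveOrder (by linarith [hU.1]) hord, hord⟩
  · rintro ⟨U, hU, μ, -, hord⟩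
    exact ⟨U, hU, μ, hord⟩

/-- … and the crux itself is equivalent to its band-window restriction. -/
theorem crux_iff_inWindow :
    FixedPointDWaveOrder ↔ ∃ U ∈ Icc (2:ℝ) 3, ∃ δ ∈ Icc (1/5:ℝ) (7/20), ∃ μ ∈ Icc (-4:ℝ) (4 + U),
      DensityClause U δ μ ∧ HasDWaveOrder U μ := by
  constructor
  · rintro ⟨U, hU, δ, hδ, μ, hd, hord⟩
    exact ⟨U, hU, δ, hδ, μ, mem_band_window_of_hasDWaveOrder (by linarith [hU.1]) hord, hd, hord⟩
  · rintro ⟨U, hU, δ, hδ, μ, -, hd, hord⟩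
    exact ⟨U, hU, δ, hδ, μ, hd, hord⟩

/-- `gcDensity U μ L = 0` below the band from side `3` on. -/
theorem gcDensity_eq_zero_below_band {U μ : ℝ} (hU : 0 ≤ U) (hμ : μ < -4) {L : ℕ} (hL : 2 ≤ L) :
    gcDensity U μ L = 0 := by
  rw [gcDensity, re_groundStateFunctional_totalNumber_eq_zero (by omega) hU hμ, zero_div]

/-- **The density clause fails below the band** for every admissible doping (`1 - δ ≠ 0`): the density tends to `0`. -/
theorem not_densityClause_below_band {U δ μ : ℝ} (hU : 0 ≤ U) (hμ : μ < -4) (hδ : δ ≠ 1) :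
    ¬ DensityClause U δ μ := by
  intro hd
  have h0 : Tendsto (fun L : ℕ => gcDensity U μ L) atTop (𝓝 0) := by
    refine tendsto_const_nhds.congr' ?_
    filter_upwards [eventually_ge_atTop 2] with L hL
    exact (gcDensity_eq_zero_below_band hU hμ hL).symm
  have := tendsto_nhds_unique hd h0
  exact hδ (by linarith)

/-- **Load-bearing reading**: the `μ`-witness of `CruxWithoutDensity` (density clause dropped) cannot lie below the band. -/
theorem not_cruxWithoutDensity_below_band :
    ¬ ∃ U ∈ Icc (2:ℝ) 3, ∃ μ : ℝ, μ < -4 ∧ HasDWaveOrder U μ := by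
  rintro ⟨U, hU, μ, hμ, hord⟩
  exact not_hasDWaveOrder_below_band (by linarith [hU.1]) hμ hord

/-- … and the below-band region is DOUBLY dead for the crux itself: both conjuncts fail there. -/
theorem crux_conjuncts_fail_below_band {U δ μ : ℝ} (hU : U ∈ Icc (2:ℝ) 3) (hδ : δ ∈ Icc (1/5:ℝ) (7/20))
    (hμ : μ < -4) : ¬ DensityClause U δ μ ∧ ¬ HasDWaveOrder U μ :=
  ⟨not_densityClause_below_band (by linarith [hU.1]) hμ (by linarith [hδ.2]),
    not_hasDWaveOrder_below_band (by linarith [hU.1]) hμ⟩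

/-- The interaction is load-bearing, below-band half: at `U = 0` the order clause fails for every `μ < -4` as well. -/
theorem not_cruxAtFreeCoupling_below_band :
    ¬ ∃ δ ∈ Icc (1/5:ℝ) (7/20), ∃ μ : ℝ, μ < -4 ∧ DensityClause 0 δ μ ∧ HasDWaveOrder 0 μ := by
  rintro ⟨δ, -, μ, hμ, -, hord⟩
  exact not_hasDWaveOrder_below_band le_rfl hμ hord

/-- Combined: no witness of `CruxAtFreeCoupling` has `μ < 0`, `μ ≠ -4`. -/
theorem not_cruxAtFreeCoupling_offBand_or_inBand {δ μ : ℝ} (_hδ : δ ∈ Icc (1/5:ℝ) (7/20)) (hμ : μ < 0) (hμ4 : μ ≠ -4)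
    (hord : HasDWaveOrder 0 μ) : False := by
  rcases lt_or_gt_of_ne hμ4 with h | h
  · exact not_hasDWaveOrder_below_band le_rfl h hord
  · exact Summit.HubbardSuperconductivity.HubbardSuperconductivity.Theorems.NodalReduction.Negative.not_hasDWaveOrder_free μ ⟨h, hμ⟩ hord

/-- `gcDensity U μ L = 2` above the band from side `3` on. -/
theorem gcDensity_eq_two_above_band {U μ : ℝ} (hU : 0 ≤ U) (hμ : 4 + U < μ) {L : ℕ} (hL : 2 ≤ L) :
    gcDensity U μ L = 2 := by
  have hpos : (0:ℝ) < ((L + 1 : ℕ) : ℝ) ^ 2 := by positivity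
  rw [gcDensity, re_groundStateFunctional_totalNumber_eq_two_mul (by omega) hU hμ, mul_div_assoc, div_self hpos.ne', mul_one]

/-- **The density clause fails above the band** for every doping `δ ≠ -1`: the density tends to `2`. -/
theorem not_densityClause_above_band {U δ μ : ℝ} (hU : 0 ≤ U) (hμ : 4 + U < μ) (hδ : δ ≠ -1) :
    ¬ DensityClause U δ μ := by
  intro hd
  have h2 : Tendsto (fun L : ℕ => gcDensity U μ L) atTop (𝓝 2) := by
    refine tendsto_const_nhds.congr' ?_
    filter_upwards [eventually_ge_atTop 2] with L hL
    exact (gcDensity_eq_two_above_band hU hμ hL).symm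
  have := tendsto_nhds_unique hd h2
  exact hδ (by linarith)

/-- The above-band region is doubly dead for the crux as well. -/
theorem crux_conjuncts_fail_above_band {U δ μ : ℝ} (hU : U ∈ Icc (2:ℝ) 3) (hδ : δ ∈ Icc (1/5:ℝ) (7/20))
    (hμ : 4 + U < μ) : ¬ DensityClause U δ μ ∧ ¬ HasDWaveOrder U μ :=
  ⟨not_densityClause_above_band (by linarith [hU.1]) hμ (by linarith [hδ.1]),
    not_hasDWaveOrder_above_band (by linarith [hU.1]) hμ⟩

/-- **The density clause ALONE also forces the band window** (for dopings in the box): both conjuncts of the crux,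
independently, confine `μ` to `[-4, 4 + U]`. -/
theorem mem_band_window_of_densityClause {U δ μ : ℝ} (hU : 0 ≤ U) (hδ : δ ∈ Icc (1/5:ℝ) (7/20))
    (hd : DensityClause U δ μ) : μ ∈ Icc (-4:ℝ) (4 + U) := by
  by_contra hμ
  rw [Set.mem_Icc, not_and_or, not_le, not_le] at hμ
  rcases hμ with hμ | hμ
  · exact not_densityClause_below_band hU hμ (by linarith [hδ.2]) hd
  · exact not_densityClause_above_band hU hμ (by linarith [hδ.1]) hd

/-! ## §6 Junk audit (checked examples) -/

/-- `HasDWaveOrder` is literally strict positivity of the order parameter. -/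
example (U μ : ℝ) : HasDWaveOrder U μ ↔ 0 < dWaveOrderParameter U μ := Iff.rfl

/-- The order parameter is a genuine real number in `[0, 4√2]` for ALL `U, μ`: the double `liminf` is junk-free. -/
example (U μ : ℝ) : 0 ≤ dWaveOrderParameter U μ ∧
    dWaveOrderParameter U μ ≤ 2 * ∑ e ∈ insert (0 : Site 2) unitSteps, |dWaveFormFactor e / Real.sqrt 2| :=
  ⟨dWaveOrderParameter_nonneg U μ, dWaveOrderParameter_le_const U μ⟩

/-- The normalising volume is positive: no division-by-zero junk in the density clause. -/
example (L : ℕ) : (0:ℝ) < ((L + 1 : ℕ) : ℝ) ^ 2 := by positivity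

/-- The source-free and sourced torus Hamiltonians are Hermitian: the tracial ground state is the honest one. -/
example (L : ℕ) [NeZero L] (U μ h : ℝ) :
    (hubbardTorusWith 2 L 1 U μ).IsHermitian ∧ (dWaveSourceTorus L U μ h).IsHermitian :=
  ⟨isHermitian_hubbardTorusWith L 1 U μ, dWaveSourceTorus_isHermitian L (isHermitian_hubbardTorusWith L 1 U μ) h⟩

/-- The `h = 0` slice of the sourced density vanishes identically (`U(1)`): the source is what the order clause is about. -/
example (L : ℕ) [NeZero L] (U μ : ℝ) : dWaveSourceDensity L U μ 0 = 0 := dWaveSourceDensity_zero L U μ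

/-- The grand-canonical density per site lies in `[0, 2]` on every torus (tree `gcDensity_torus_mem_Icc`): the density
clause's sequence is bounded, its `Tendsto` is contentful and `1 - δ ∈ [0.65, 0.8] ⊂ [0, 2]` is attainable in principle. -/
example (L : ℕ) (U μ : ℝ) : gcDensity U μ L ∈ Icc (0:ℝ) 2 :=
  gcDensity_torus_mem_Icc (L + 1) 1 U μ

end Summit.HubbardSuperconductivity.HubbardSuperconductivity.Cruxes.FixedPointDWaveOrder.Disproof
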